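import Summits.AtomisticToContinuum.HydrodynamicLimit.Theses.ImplosionDichotomy
import Summits.AtomisticToContinuum.HydrodynamicLimit.Theorems.DenseExcursion.Negative.Everywhere

/-!
# No BULK polynomial compression: every witness of `PolynomialCompression` concentrates on volume `≤ σ^κ`

Negative knowledge for the crux `ImplosionDichotomy.PolynomialCompression` (stmt-AtomisticToContinuum-12587), from
the standing disprover's `Cruxes/PolynomialCompression/Disproof.lean` §10 (cycle 3; refuted strengthening,
pattern (c), and a tightness bound, pattern (b)). `PolynomialCompressionEverywhere` is the crux VERBATIM with the
final `∃ x, σ^(-κ) ≤ ρ_t(x)` strengthened to `∀ x, σ^(-κ) ≤ ρ_t(x)`, and it is FALSE, unconditionally (no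
hypothesis on the equation of state): MASS IS CONSERVED along every classical hard-sphere-Euler solution and
ADMISSIBLE MASS IS ONE (both imported from the sibling crux's `DenseExcursionEverywhere`: continuity equation +
divergence theorem on `𝕋³`; the tie tested with `χ ≡ 1`), so by Markov's inequality the compression set
`{x | σ^(-κ) ≤ ρ_t(x)}` of ANY admissible classical solution has volume `≤ σ^κ → 0`
(`volume_real_compressionSet_le`) — in particular it is never all of `𝕋³` once `σ < 1`. Quantitatively: a witness
of the crux at exponent `κ` is a concentration of (at most unit) mass on a set of measure `σ^κ`; the intended
self-similar implosion (core density `≍ (T−t)^{−β}`, `β = 3(1−1/r)`, core radius `(T−t)^{1/r}`) has, at the time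
its core reaches `σ^(-κ)`, a compression set of volume `≍ σ^{κ/(r−1)} ≪ σ^κ` (`r − 1 < 0.27`) — consistent.
refuter-cdisprove-stmt-AtomisticToContinuum-12587-g3-0.
-/

noncomputable section

namespace Summit.AtomisticToContinuum.HydrodynamicLimit.Theorems

open MeasureTheory Filter Set Topology
open scoped ENNReal
open Literature.MathematicalPhysics.KineticTheory Literature.Analysis.FluidPDE
open Literature.Analysis.FunctionSpaces

/-- The crux `PolynomialCompression` strengthened to reach density `σ^(-κ)` EVERYWHERE at some time (all else
verbatim). -/
def PolynomialCompressionEverywhere : Prop :=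
  ∃ κ : ℝ, 0 < κ ∧ ∃ (a₀ θ₀ : Literature.MathematicalPhysics.KineticTheory.T3 → ℝ) (u₀ : Literature.MathematicalPhysics.KineticTheory.T3 → Literature.MathematicalPhysics.KineticTheory.V3), Continuous a₀ ∧ Continuous θ₀ ∧ Continuous u₀ ∧ (∀ x, 0 < a₀ x) ∧ (∀ x, 0 < θ₀ x) ∧ ∀ σ₀ : ℝ, 0 < σ₀ → ∃ σ : ℝ, 0 < σ ∧ σ < σ₀ ∧ ∃ (T : ℝ) (ρ θ : ℝ → Literature.MathematicalPhysics.KineticTheory.T3 → ℝ) (u : ℝ → Literature.MathematicalPhysics.KineticTheory.T3 → Literature.MathematicalPhysics.KineticTheory.V3), Literature.MathematicalPhysics.KineticTheory.IsHardSphereEulerSolution σ T ρ u θ ∧ (∀ Φ : (N : ℕ) → Literature.Analysis.FluidPDE.HardSphereFlow (Literature.Analysis.FluidPDE.Torus.geometry (Fin 3)) (Literature.MathematicalPhysics.KineticTheory.hsDiameter σ N) (N + 1), Literature.MathematicalPhysics.KineticTheory.TendstoHydroFieldsAt (fun N => Literature.MathematicalPhysics.KineticTheory.localGibbsLaw σ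 a₀ u₀ θ₀ N (Φ N)) Φ ρ u θ 0) ∧ ∃ t ∈ Set.Ico 0 T, ∀ x, σ ^ (-κ) ≤ ρ t x

namespace PolynomialCompressionEverywhere

open DenseExcursionEverywhere (integral_density_eq integral_density_zero_eq_one)

/-- **Unit mass at all times**: along a classical hard-sphere-Euler solution tied at `t = 0` to the local Gibbs
laws through some flow family (`σ ≤ 1/2`), `∫ ρ(t) = 1` for every `t ∈ [0, T)`. [folklore] -/
theorem integral_density_eq_one {σ T : ℝ} (hσ2 : σ ≤ 1 / 2) {a₀ θ₀ : T3 → ℝ} {u₀ : T3 → V3}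
    (ha : Continuous a₀) (hθ : Continuous θ₀) (hu : Continuous u₀) (ha0 : ∀ x, 0 < a₀ x)
    (hθ0 : ∀ x, 0 < θ₀ x) {ρ θ : ℝ → T3 → ℝ} {u : ℝ → T3 → V3} (hE : IsHardSphereEulerSolution σ T ρ u θ)
    (Φ : (N : ℕ) → HardSphereFlow (Torus.geometry (Fin 3)) (hsDiameter σ N) (N + 1))
    (hA : TendstoHydroFieldsAt (fun N => localGibbsLaw σ a₀ u₀ θ₀ N (Φ N)) Φ ρ u θ 0)
    {t : ℝ} (ht : t ∈ Ico 0 T) : ∫ x, ρ t x = 1 := by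
  rw [integral_density_eq hE ht]
  exact integral_density_zero_eq_one hσ2 ha hθ hu ha0 hθ0 Φ hA

/-- **VOLUME OF THE COMPRESSION SET** (tightness of every witness of the crux): along an admissible classical
hard-sphere-Euler solution (`σ ≤ 1/2`, tie through some flow family), at every time `t ∈ [0,T)` the set where the
density is `≥ σ^(-κ)` has volume `≤ σ^κ` — Markov's inequality against the conserved unit mass (`ρ > 0`).
[folklore] -/
theorem volume_real_compressionSet_le {σ T : ℝ} (hσ : 0 < σ) (hσ2 : σ ≤ 1 / 2) {a₀ θ₀ : T3 → ℝ}
    {u₀ : T3 → V3} (ha : Continuous a₀) (hθ : Continuous θ₀) (hu : Continuous u₀) (ha0 : ∀ x, 0 < a₀ x)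
    (hθ0 : ∀ x, 0 < θ₀ x) {ρ θ : ℝ → T3 → ℝ} {u : ℝ → T3 → V3} (hE : IsHardSphereEulerSolution σ T ρ u θ)
    (Φ : (N : ℕ) → HardSphereFlow (Torus.geometry (Fin 3)) (hsDiameter σ N) (N + 1))
    (hA : TendstoHydroFieldsAt (fun N => localGibbsLaw σ a₀ u₀ θ₀ N (Φ N)) Φ ρ u θ 0)
    {t : ℝ} (ht : t ∈ Ico 0 T) (κ : ℝ) :
    volume.real {x | σ ^ (-κ) ≤ ρ t x} ≤ σ ^ κ := by
  set A : Set T3 := {x | σ ^ (-κ) ≤ ρ t x} with hA_def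
  have hcont : Continuous (ρ t) := (hE.smooth_density.isSmooth_slice ht).continuous
  have hAm : MeasurableSet A := (isClosed_le continuous_const hcont).measurableSet
  have hint : Integrable (ρ t) volume := integrable_of_continuous_T3 hcont
  have hpow : 0 < σ ^ (-κ) := Real.rpow_pos_of_pos hσ _
  have h1 : ∫ x in A, σ ^ (-κ) ∂volume ≤ ∫ x in A, ρ t x ∂volume :=
    setIntegral_mono_on (integrable_const _).integrableOn hint.integrableOn hAm fun x hx => hx
  have h2 : ∫ x in A, ρ t x ∂volume ≤ ∫ x, ρ t x :=
    setIntegral_le_integral hint (Eventually.of_forall fun x => (hE.density_pos t ht x).le)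
  rw [setIntegral_const, smul_eq_mul] at h1
  have h3 : volume.real A * σ ^ (-κ) ≤ 1 := by
    have h12 := h1.trans h2
    rwa [integral_density_eq_one hσ2 ha hθ hu ha0 hθ0 hE Φ hA ht] at h12
  rw [Real.rpow_neg hσ.le, ← div_eq_mul_inv, div_le_iff₀ (Real.rpow_pos_of_pos hσ κ), one_mul] at h3
  exact h3

end PolynomialCompressionEverywhere

open PolynomialCompressionEverywhere in
/-- NO BULK COMPRESSION: `PolynomialCompression` with `∃ x` strengthened to `∀ x` is false — at the offending time
the compression set would be all of `𝕋³`, of volume `1 ≤ σ^κ < 1` (take `σ < min(1/2, 1)` in the witness; a flow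
family to test the tie through exists by Alexander's theorem). [folklore] -/
theorem polynomialCompression_false_everywhere : ¬ PolynomialCompressionEverywhere := by
  rintro ⟨κ, hκ, a₀, θ₀, u₀, ha, hθ, hu, ha0, hθ0, H⟩
  obtain ⟨σ, hσ, hσlt, T, ρ, θ, u, hE, hA, t, ht, hx⟩ := H (1 / 2) (by norm_num)
  have hσone : σ < 1 := hσlt.trans (by norm_num)
  obtain ⟨Φ⟩ : Nonempty ((N : ℕ) → HardSphereFlow (Torus.geometry (Fin 3)) (hsDiameter σ N) (N + 1)) :=
    ⟨fun N => Classical.choice (HardSphereFlow.nonempty_torus_holds (d := Fin 3)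
      (hsDiameter_pos hσ N) ((hsDiameter_le hσ.le N).trans_lt (hσlt.trans_eq (by norm_num))) (N + 1))⟩
  have hvol := volume_real_compressionSet_le hσ hσlt.le ha hθ hu ha0 hθ0 hE Φ (hA Φ) ht κ
  have huniv : {x | σ ^ (-κ) ≤ ρ t x} = univ := eq_univ_of_forall hx
  rw [huniv, probReal_univ] at hvol
  exact absurd hvol (not_le.2 (Real.rpow_lt_one hσ.le hσone hκ))

end Summit.AtomisticToContinuum.HydrodynamicLimit.Theorems

end
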